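import Summits.BirchSwinnertonDyer.Rank1Residual.GaloisImage.EPCMultiplicative
import Literature.NumberTheory.GaloisRepresentations.LocalFieldCdTwo
import Literature.NumberTheory.GaloisRepresentations.PPrimaryDevissage
import Mathlib.LinearAlgebra.Quotient.Card
import HarnessLib

/-!
# Wild dévissage for Tate's local Euler–Poincaré formula
# (cell `b2b-bsdres`, team n1011, row T-EPC = Tate's local Euler–Poincaré characteristic; seat p04 GEN 8; stage D3a)

HONEST FRAMING (cell `b2b-bsdres`, run/shared/lean/b2b/bsd-rank1-residual/, verbatim in every
file): the goal of the cell is to DELETE the COMBINATION-SHAPED residual classes of the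
Birch–Swinnerton-Dyer formula for ALL analytic-rank `≤ 1` elliptic curves over `ℚ` — "full BSD
formula for every rank `≤ 1` curve in class `C`" assembled STRICTLY from published theorems — so
that the rank-`≤ 1` remainder becomes exactly the CONSTRUCTION-SHAPED classes, which are TYPED
(missing-input `Prop`s), NOT attempted. This is not "finishing BSD". Team n1011 (N10 / N11, the
additive block X4 ∧ `p = 3`): research route; no claim beyond the stated classes; nothing is
booked; no mark / label is changed by this file. Theorems only (no definition, no named fact, no
`sorry`).  (Placement: Summits/GaloisImage with the T-EPC cone.)

## What

`EPCDevissage.localEPC_of_forall_trivial` — let `V ⊴ Γ_F` be open normal and `J ⊴ Γ_F` normal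
with `J V / V` a `p`-group (in the application `J = I_F^{v}` is a wild ramification group).  If
Tate's formula holds for every finite discrete `Γ_F`-module killed by `p` on which `V` **and** `J`
act trivially, then it holds for every finite discrete `Γ_F`-module killed by `p` on which `V`
acts trivially: induction on `#M` through `0 → M^J → M → M/M^J → 0` (`M^J ≠ 0` because a
`p`-group acting on a non-zero finite `p`-group has a non-zero fixed vector, tree
`exists_ne_zero_forall_apply_eq`; `M^J` is `Γ_F`-stable as `J` is normal), multiplicativity
(stage D1 `EPCMul.localEPC_of_isSES`) and `H³ = 0` (`cd_p Γ_F ≤ 2`).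

References: J.-P. Serre, *Galois Cohomology* (1997), II §5.7 [SerreGaloisCohomology1997];
J. S. Milne, *Arithmetic Duality Theorems* (2006), I §2 Thm. 2.8 [MilneADT2006].
-/

noncomputable section

open CategoryTheory Function Field
open scoped ValuativeRel
open Literature.NumberTheory.GaloisRepresentations

universe u

namespace Summit.BirchSwinnertonDyer.Rank1Residual.GaloisImage

namespace EPCDevissage

variable (F : Type u) [Field F] [ValuativeRel F] [TopologicalSpace F] [IsNonarchimedeanLocalField F]
  [CharZero F]
variable {p : ℕ} [hp : Fact p.Prime]

omit hp in
/-- If `J V / V` is a `p`-group then so is `J / (V ∩ J)` (elementwise: `j^{p^k} ∈ V`). [folklore] -/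
theorem isPGroup_quotient_subgroupOf {Γ : Type*} [Group Γ] (V J : Subgroup Γ) [V.Normal]
    (hP : IsPGroup p (J.map (QuotientGroup.mk' V))) : IsPGroup p (J ⧸ V.subgroupOf J) := by
  haveI : (V.subgroupOf J).Normal := inferInstance
  intro q
  induction q using QuotientGroup.induction_on with
  | H j =>
    obtain ⟨k, hk⟩ := hP ⟨QuotientGroup.mk' V (j : Γ), Subgroup.mem_map_of_mem _ j.2⟩
    refine ⟨k, ?_⟩
    have hk' : (QuotientGroup.mk' V ((j : Γ) ^ p ^ k)) = 1 := by
      have := congrArg Subtype.val hk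
      rwa [SubmonoidClass.coe_pow, ← map_pow] at this
    rw [QuotientGroup.mk'_apply, QuotientGroup.eq_one_iff] at hk'
    rw [← QuotientGroup.mk_pow, QuotientGroup.eq_one_iff, Subgroup.mem_subgroupOf, SubgroupClass.coe_pow]
    exact hk'

/-- **Wild dévissage.** `V ⊴ Γ_F` open normal, `J ⊴ Γ_F` normal with `J V / V` a `p`-group; if
Tate's local Euler–Poincaré formula holds for the finite discrete `p`-torsion `Γ_F`-modules with
trivial `V`- and `J`-action, it holds for those with trivial `V`-action.
[cite: SerreGaloisCohomology1997, II §5.7] [cite: MilneADT2006, I §2 Thm 2.8 (proof)] -/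
theorem localEPC_of_forall_trivial (V J : Subgroup (absoluteGaloisGroup F)) [hVn : V.Normal] [J.Normal]
    (hVo : IsOpen (V : Set (absoluteGaloisGroup F))) (hP : IsPGroup p (J.map (QuotientGroup.mk' V)))
    (H : ∀ {A : Type u} [AddCommGroup A] [TopologicalSpace A] [DiscreteTopology A] [Finite A]
      (τ : ContinuousRep (absoluteGaloisGroup F) ℤ A), (∀ a : A, p • a = 0) →
      (∀ g ∈ V, ∀ a : A, τ g a = a) → (∀ g ∈ J, ∀ a : A, τ g a = a) →
      Finite (continuousCohomology 1 τ.toTopRep) ∧ Finite (continuousCohomology 2 τ.toTopRep) ∧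
        Nat.card τ.toTopRep.ρ.invariants * Nat.card (continuousCohomology 2 τ.toTopRep) *
            Nat.card (𝒪[F] ⧸ Ideal.span {((Nat.card A : ℕ) : 𝒪[F])}) =
          Nat.card (continuousCohomology 1 τ.toTopRep))
    {M : Type u} [AddCommGroup M] [TopologicalSpace M] [DiscreteTopology M] [Finite M]
    (ρ : ContinuousRep (absoluteGaloisGroup F) ℤ M) (hpM : ∀ m : M, p • m = 0)
    (hV : ∀ g ∈ V, ∀ m : M, ρ g m = m) :
    Finite (continuousCohomology 1 ρ.toTopRep) ∧ Finite (continuousCohomology 2 ρ.toTopRep) ∧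
      Nat.card ρ.toTopRep.ρ.invariants * Nat.card (continuousCohomology 2 ρ.toTopRep) *
          Nat.card (𝒪[F] ⧸ Ideal.span {((Nat.card M : ℕ) : 𝒪[F])}) =
        Nat.card (continuousCohomology 1 ρ.toTopRep) := by
  haveI := absoluteGaloisGroup_compactSpace F
  haveI : Finite (absoluteGaloisGroup F ⧸ V) := Subgroup.quotient_finite_of_isOpen V hVo
  haveI : V.FiniteIndex := Subgroup.finiteIndex_of_finite_quotient
  -- strong induction on `#M`
  suffices key : ∀ (k : ℕ) {M : Type u} [AddCommGroup M] [TopologicalSpace M] [DiscreteTopology M]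
      [Finite M] (ρ : ContinuousRep (absoluteGaloisGroup F) ℤ M), Nat.card M = k → (∀ m : M, p • m = 0) →
      (∀ g ∈ V, ∀ m : M, ρ g m = m) →
      Finite (continuousCohomology 1 ρ.toTopRep) ∧ Finite (continuousCohomology 2 ρ.toTopRep) ∧
        Nat.card ρ.toTopRep.ρ.invariants * Nat.card (continuousCohomology 2 ρ.toTopRep) *
            Nat.card (𝒪[F] ⧸ Ideal.span {((Nat.card M : ℕ) : 𝒪[F])}) =
          Nat.card (continuousCohomology 1 ρ.toTopRep) from key _ ρ rfl hpM hV
  intro k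
  induction k using Nat.strong_induction_on with
  | _ k ih =>
  intro M _ _ _ _ ρ hk hpM hV
  classical
  by_cases hJ : ∀ g ∈ J, ∀ m : M, ρ g m = m
  · exact H ρ hpM hV hJ
  -- `W = M^J`, a proper non-zero `Γ`-stable submodule
  have hprim : IsPrimaryTorsion p M := fun m => ⟨1, by rw [pow_one]; exact hpM m⟩
  set W : Submodule ℤ M := ρ.invariantsOf J with hWdef
  have hW : ∀ g, W ≤ W.comap (ρ g) := Representation.le_comap_invariants ρ.toRepresentation J
  have hWtop : W ≠ ⊤ := by
    intro h
    apply hJ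
    intro g hg m
    have hm : m ∈ W := by rw [h]; exact Submodule.mem_top
    exact (ρ.mem_invariantsOf_iff J m).1 hm ⟨g, hg⟩
  haveI : Nontrivial M := by
    by_contra h
    haveI := not_nontrivial_iff_subsingleton.1 h
    exact hWtop (Subsingleton.elim _ _)
  -- a non-zero `J`-fixed vector: `J/(V ∩ J)` is a `p`-group acting on the `p`-group `M`
  have hWbot : ∃ b : M, b ≠ 0 ∧ b ∈ W := by
    haveI : (V.subgroupOf J).Normal := inferInstance
    haveI : Finite (J ⧸ V.subgroupOf J) := Subgroup.finite_quotient_of_finiteIndex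
    obtain ⟨b, hb0, hb⟩ := exists_ne_zero_forall_apply_eq (V.subgroupOf J)
      (isPGroup_quotient_subgroupOf V J hP) (ρ.restrict (subgroupIncl J)) hprim
      (fun g hg b => by
        rw [ContinuousRep.restrict_apply, subgroupIncl_apply]
        exact hV _ (Subgroup.mem_subgroupOf.1 hg) b)
    exact ⟨b, hb0, (ρ.mem_invariantsOf_iff J b).2 fun j => hb j⟩
  obtain ⟨b, hb0, hbW⟩ := hWbot
  -- the cardinalities of the pieces
  have hcardW : 1 < Nat.card W :=
    Finite.one_lt_card_iff_nontrivial.2 ⟨⟨⟨b, hbW⟩, 0, fun h => hb0 (congrArg Subtype.val h)⟩⟩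
  have hcardQ : 1 < Nat.card (M ⧸ W) := by
    refine Finite.one_lt_card_iff_nontrivial.2 ?_
    rw [Submodule.Quotient.nontrivial_iff]
    exact hWtop
  have hmul : Nat.card M = Nat.card W * Nat.card (M ⧸ W) := Submodule.card_eq_card_quotient_mul_card W
  have hWlt : Nat.card W < k := by rw [← hk, hmul]; exact lt_mul_right Nat.card_pos hcardQ
  have hQlt : Nat.card (M ⧸ W) < k := by rw [← hk, hmul]; exact lt_mul_left Nat.card_pos hcardW
  -- induction hypotheses for the pieces
  have hA := ih _ hWlt (ρ.subrepresentation W hW) rfl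
    (fun w => Subtype.ext (by
      rw [Submodule.coe_smul_of_tower]
      exact hpM w))
    (fun g hg w => Subtype.ext (by rw [ContinuousRep.subrepresentation_apply_coe]; exact hV g hg w))
  have hpQ : ∀ q : M ⧸ W, p • q = 0 := fun q => by
    induction q using Submodule.Quotient.induction_on with
    | H m => rw [← Submodule.mkQ_apply, ← map_nsmul, hpM, map_zero]
  have hVQ : ∀ g ∈ V, ∀ q : M ⧸ W, ρ.quotient W hW g q = q := fun g hg q => by
    induction q using Submodule.Quotient.induction_on with
    | H m => rw [ContinuousRep.quotient_apply_mk, hV g hg m]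
  have hQ := ih _ hQlt (ρ.quotient W hW) rfl hpQ hVQ
  haveI : Subsingleton (continuousCohomology 3 (ρ.subrepresentation W hW).toTopRep) :=
    subsingleton_continuousCohomology_of_two_lt F (ρ.subrepresentation W hW)
      (fun w => ⟨1, by
        rw [pow_one]
        exact Subtype.ext (by rw [Submodule.coe_smul_of_tower]; exact hpM w)⟩) (by norm_num)
  exact EPCMul.localEPC_of_isSES F (isSES_subtype_mkQ ρ W hW) hA hQ

end EPCDevissage

end Summit.BirchSwinnertonDyer.Rank1Residual.GaloisImage

end
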